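import Summits.CriticalPhenomena.PercolationContinuityZ3.Theorems.PercNearOneGluingNoHeavyLowerTailSahiAllButTwo

/-!
# `NoHeavyLowerTail` (crux stmt-CriticalPhenomena-4575), Sahi / Kahn positivity: the ALL-BUT-TWO slot (III) — row (a) for EVERY `k`

Support file (cell `prim-l12`, seat P3, gen 21; `--supports stmt-CriticalPhenomena-4575`).  No `sorry`, no named facts, standard axioms.  Memo
`run/shared/lean/prim/prim-l12/FROM-prim-l12-p3-g21-*.md`.

`…SahiAllButTwo.rhoCert_allButTwo` (gen 20) made `ρ₂ = μ(· | exactly two closed)` a reduced transport certificate of the all-but-two pattern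
event `Th_{k−2}^k` under TWO hypotheses: the capacity row (a) `Θ(r)·D(r) ≤ (Π(r)+D(r))·e₂(r)` and the (TC) row `Ñ₂ ≥ 0` at the odds.  On five
coordinates (a) was a 3125-entry table check (`…SahiAllButTwoFive.coeff_aPoly_nonneg`).  THIS FILE proves (a) for every number of coordinates:

* `coeff_Th1_mul_Dd_le` : `Θ₁·D ≤ Π·e₂` COEFFICIENTWISE on any finite ground type (`Θ₁` = sets of size `≤ 1`, `D` = size `≥ 3`, `Π` = all sets,
  `e₂` = 2-sets).  In probabilistic terms (`W·GF(K)(r)` = probability that the closed set lies in `K`): `P(N ≤ 1)·P(N ≥ 3) ≤ P(N = 2)` for the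
  number `N` of closed coordinates of ANY product measure — and in fact monomial by monomial.  Proof: at a profile with doubled set `D` and
  support `N` (`#N = m`, `#D = d`) the left side counts the pairs `(P, S)` with `P ∩ S = D`, `P ∪ S = N`, `#P ≤ 1`, `#S ≥ 3` — at most `1 + m·[m ≥ 4]`
  of them if `d = 0`, at most one if `d = 1`, none if `d ≥ 2` — and the right side counts the 2-sets `S` with `D ⊆ S ⊆ N`: `C(m,2)`, `m − 1`, … .
* `coeff_aPoly_nonneg_gen` : `(Π + D)·e₂ − Θ·D = Π·e₂ − Θ₁·D ∈ ℕ[r]`;  `aRow` : row (a) at the odds vector of interior parameters, every `k`.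
* `rhoCert_allButTwo_of_N2`, `sahiE_three_nonneg_of_allButTwo_of_N2` : the gen-20 theorems with hypothesis (a) DISCHARGED — for every `k ≥ 2`,
  `ρ₂` is a reduced transport certificate of `Th_{k−2}^k`, hence Kahn's Conjecture 5 / Sahi's `C₃` holds for the all-but-two first slot on `k`
  coordinates, AS SOON AS `Ñ₂(K_𝒳,K_𝒵)(r) ≥ 0` for all nonempty up-sets `𝒳, 𝒵` (the c = 2 coefficientwise threshold certificate conjecture CTC₂
  implies this for every `k`; `…SahiCTCN2Five` proves it on five points).
Nothing is asserted about the crux.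
-/

noncomputable section

open scoped Classical

namespace Summit.CriticalPhenomena.PercolationContinuityZ3.Theorems

namespace SahiAllButTwo

open Finset MvPolynomial
open SahiHittingSlot SahiTransportCert SahiAllButOne SahiCTCForms SahiCTCGenFun SahiCTCWeightedLYM
open Literature.Combinatorics.Sahi2008
open Literature.Probability.Percolation (DeterminedBy)
open Literature.Probability.Percolation.DecisionTree (ind)

section Coeff

variable {α : Type*} [DecidableEq α] [Fintype α]

/-- **The pair count behind row (a).**  For `D ⊆ N`: the pairs `(P, S)` of subsets with `P ∩ S = D`, `P ∪ S = N`, `#P ≤ 1`, `#S ≥ 3` are at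
most as many as the pairs with `#S = 2` (no condition on `P`). [this work] -/
theorem card_pairs_rowA (D N : Finset α) (hDN : D ⊆ N) :
    #(pairs (univ.powerset : Finset (Finset α)) D N (· ≤ 1) (3 ≤ ·)) ≤
      #(pairs (univ.powerset : Finset (Finset α)) D N (0 ≤ ·) (· = 2)) := by
  set 𝒰 := (univ.powerset : Finset (Finset α)) with h𝒰
  rcases (pairs 𝒰 D N (· ≤ 1) (3 ≤ ·)).eq_empty_or_nonempty with h0 | hne
  · rw [h0, card_empty]; exact Nat.zero_le _
  obtain ⟨PS, hPS⟩ := hne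
  obtain ⟨-, hI, hU, hP1, hS3⟩ := mem_pairs.1 hPS
  have hDP : D ⊆ PS.1 := by rw [← hI]; exact inter_subset_left
  have hd1 : #D ≤ 1 := (card_le_card hDP).trans hP1
  have hsum := card_add_card_of_inter_union hI hU
  have hN3 : 3 ≤ #N := by
    have : PS.2 ⊆ N := by rw [← hU]; exact subset_union_right
    have := card_le_card this
    omega
  rcases Nat.lt_or_ge #D 1 with hd0 | hd1'
  · -- `D = ∅`
    have hD : D = ∅ := card_eq_zero.1 (by omega)
    subst hD
    -- the left pairs are `(∅, N)` and, if `#N ≥ 4`, the `({x}, N.erase x)`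
    have hsub : pairs 𝒰 ∅ N (· ≤ 1) (3 ≤ ·) ⊆
        insert ((∅ : Finset α), N) ((N.filter fun _ => 4 ≤ #N).image fun x => (({x} : Finset α), N.erase x)) := by
      intro QT hQT
      obtain ⟨-, hI', hU', hP', hS'⟩ := mem_pairs.1 hQT
      have hsum' := card_add_card_of_inter_union hI' hU'
      rw [card_empty, add_zero] at hsum'
      rw [mem_insert, mem_image]
      rcases Nat.lt_or_ge #QT.1 1 with h0 | h1
      · left
        have hQ : QT.1 = ∅ := card_eq_zero.1 (by omega)
        have hT : QT.2 = N := by rw [← hU', hQ, empty_union]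
        exact Prod.ext hQ hT
      · right
        have hQ1 : #QT.1 = 1 := le_antisymm hP' h1
        obtain ⟨x, hx⟩ := card_eq_one.1 hQ1
        have hxN : x ∈ N := by rw [← hU']; exact mem_union_left _ (hx ▸ mem_singleton_self x)
        refine ⟨x, mem_filter.2 ⟨hxN, by omega⟩, Prod.ext hx.symm ?_⟩
        ext z
        rw [mem_erase]
        constructor
        · rintro ⟨hzx, hzN⟩
          rw [← hU'] at hzN
          rcases mem_union.1 hzN with h | h
          · rw [hx, mem_singleton] at h; exact absurd h hzx
          · exact h
        · intro hz
          refine ⟨fun hzx => ?_, by rw [← hU']; exact mem_union_right _ hz⟩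
          have : z ∈ QT.1 ∩ QT.2 := mem_inter.2 ⟨by rw [hx, hzx]; exact mem_singleton_self x, hz⟩
          rw [hI'] at this
          exact notMem_empty z this
    -- the right pairs contain `(N ∖ S, S)` for every 2-subset `S ⊆ N`
    have hsub2 : (N.powersetCard 2).image (fun S => (N \ S, S)) ⊆ pairs 𝒰 ∅ N (0 ≤ ·) (· = 2) := by
      intro QT hQT
      obtain ⟨S, hS, rfl⟩ := mem_image.1 hQT
      obtain ⟨hSN, hS2⟩ := mem_powersetCard.1 hS
      refine mem_pairs.2 ⟨mem_powerset.2 (subset_univ _), ?_, ?_, Nat.zero_le _, hS2⟩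
      · exact sdiff_inter_self S N
      · exact sdiff_union_of_subset hSN
    have hinj : Set.InjOn (fun S : Finset α => (N \ S, S)) ↑(N.powersetCard 2) := fun S _ T _ h => congrArg Prod.snd h
    have hR : (#N).choose 2 ≤ #(pairs 𝒰 ∅ N (0 ≤ ·) (· = 2)) := by
      rw [← card_powersetCard 2 N, ← card_image_of_injOn hinj]; exact card_le_card hsub2
    have hL : #(pairs 𝒰 ∅ N (· ≤ 1) (3 ≤ ·)) ≤ #(N.filter fun _ => 4 ≤ #N) + 1 :=
      calc #(pairs 𝒰 ∅ N (· ≤ 1) (3 ≤ ·)) ≤ #(insert ((∅ : Finset α), N) ((N.filter fun _ => 4 ≤ #N).image fun x => (({x} : Finset α), N.erase x))) :=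
            card_le_card hsub
        _ ≤ #((N.filter fun _ => 4 ≤ #N).image fun x => (({x} : Finset α), N.erase x)) + 1 := card_insert_le _ _
        _ ≤ #(N.filter fun _ => 4 ≤ #N) + 1 := by gcongr; exact card_image_le
    refine hL.trans (le_trans ?_ hR)
    by_cases h4 : 4 ≤ #N
    · rw [filter_true_of_mem fun _ _ => h4]
      obtain ⟨t, ht⟩ : ∃ t, #N = t + 4 := ⟨#N - 4, by omega⟩
      rw [ht, Nat.choose_two_right, show t + 4 - 1 = t + 3 by omega, Nat.le_div_iff_mul_le two_pos]
      nlinarith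
    · rw [filter_false_of_mem fun _ _ => h4, card_empty, zero_add, show #N = 3 by omega]
      decide
  · -- `D = {x}`: the only left pair is `(D, N)`; `(D ∪ (N ∖ {x,y}), {x,y})` is a right pair
    have hD1 : #D = 1 := le_antisymm hd1 hd1'
    have hsub : pairs 𝒰 D N (· ≤ 1) (3 ≤ ·) ⊆ {(D, N)} := by
      intro QT hQT
      obtain ⟨-, hI', hU', hP', -⟩ := mem_pairs.1 hQT
      have hDQ : D ⊆ QT.1 := by rw [← hI']; exact inter_subset_left
      have hQD : QT.1 = D := (eq_of_subset_of_card_le hDQ (by rw [hD1]; exact hP')).symm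
      have hQT2 : QT.1 ⊆ QT.2 := by
        intro z hz
        have : z ∈ QT.1 ∩ QT.2 := by rw [hI', ← hQD]; exact hz
        exact (mem_inter.1 this).2
      have hT : QT.2 = N := by rw [← hU']; exact (union_eq_right.2 hQT2).symm
      rw [mem_singleton]; exact Prod.ext hQD hT
    obtain ⟨x, hx⟩ := card_eq_one.1 hD1
    have hxN : x ∈ N := hDN (hx ▸ mem_singleton_self x)
    obtain ⟨y, hyN, hyx⟩ : ∃ y ∈ N, y ≠ x := by
      by_contra h
      push Not at h
      have hNx : N ⊆ {x} := fun z hz => mem_singleton.2 (h z hz)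
      have := card_le_card hNx
      rw [card_singleton] at this
      omega
    have hmem : (D ∪ (N \ {x, y}), ({x, y} : Finset α)) ∈ pairs 𝒰 D N (0 ≤ ·) (· = 2) := by
      refine mem_pairs.2 ⟨mem_powerset.2 (subset_univ _), ?_, ?_, Nat.zero_le _, card_pair hyx.symm⟩
      · show (D ∪ (N \ {x, y})) ∩ {x, y} = D
        rw [union_inter_distrib_right, sdiff_inter_self, union_empty]
        exact inter_eq_left.2 (by rw [hx]; exact singleton_subset_iff.2 (mem_insert_self x {y}))
      · show (D ∪ (N \ {x, y})) ∪ {x, y} = N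
        rw [union_assoc, sdiff_union_of_subset (insert_subset hxN (singleton_subset_iff.2 hyN))]
        exact union_eq_right.2 hDN
    calc #(pairs 𝒰 D N (· ≤ 1) (3 ≤ ·)) ≤ #({(D, N)} : Finset (Finset α × Finset α)) := card_le_card hsub
      _ = 1 := card_singleton _
      _ ≤ #(pairs 𝒰 D N (0 ≤ ·) (· = 2)) := card_pos.2 ⟨_, hmem⟩

/-- **Row (a) coefficientwise, core form: `Θ₁·D ≤ Π·e₂`** (every coefficient of `(e₀+e₁)·e_{≥3}` is at most the corresponding coefficient of
`Π·e₂`), on any finite ground type. [this work] -/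
theorem coeff_Th1_mul_Dd_le (n : α →₀ ℕ) :
    (Th1 * Dd : MvPolynomial α ℤ).coeff n ≤ (PiP * ee 2 : MvPolynomial α ℤ).coeff n := by
  have hPi : (PiP : MvPolynomial α ℤ) = gf (univ.powerset.filter fun P : Finset α => 0 ≤ #P) := by
    unfold PiP; rw [filter_true_of_mem fun P _ => Nat.zero_le #P]
  rw [hPi]
  unfold Th1 Dd ee bySize
  rw [coeff_gf_mul_gf, coeff_gf_mul_gf]
  by_cases hn : ∀ i, n i ≤ 2
  · rw [filter_prod_eq_pairs _ (· ≤ 1) (3 ≤ ·) n hn, filter_prod_eq_pairs _ (0 ≤ ·) (· = 2) n hn]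
    have hDN : dbl n ⊆ n.support := fun i hi => by unfold dbl at hi; exact (mem_filter.1 hi).1
    exact_mod_cast card_pairs_rowA (dbl n) n.support hDN
  · rw [filter_prod_eq_empty _ _ n hn, filter_prod_eq_empty _ _ n hn]

/-- `(Π + D)·e₂ − Θ·D = Π·e₂ − Θ₁·D` (use `Θ = Θ₁ + e₂`). [this work] -/
theorem aPoly_eq : ((PiP + Dd) * ee 2 - Th * Dd : MvPolynomial α ℤ) = PiP * ee 2 - Th1 * Dd := by
  rw [Th_eq]; ring

/-- **Row (a) coefficientwise for every ground type: `(Π + D)·e₂ − Θ·D ∈ ℕ[r]`.** [this work] -/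
theorem coeff_aPoly_nonneg_gen (n : α →₀ ℕ) : 0 ≤ ((PiP + Dd) * ee 2 - Th * Dd : MvPolynomial α ℤ).coeff n := by
  rw [aPoly_eq, coeff_sub, sub_nonneg]; exact coeff_Th1_mul_Dd_le n

end Coeff

/-! ### Row (a) at the odds vector, and the certificate with (a) discharged -/

variable {k : ℕ}

/-- **Row (a) at the odds vector of interior parameters, every `k`**: `Θ(r)·D(r) ≤ (Π(r)+D(r))·e₂(r)`. [this work] -/
theorem aRow {q : Fin k → unitInterval} (hq : ∀ i, 0 < (q i : ℝ) ∧ (q i : ℝ) < 1) :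
    ev q Th * ev q Dd ≤ (ev q PiP + ev q Dd) * ev q (ee 2 : MvPolynomial (Fin k) ℤ) := by
  have h := eval_le_of_coeff_le (P := (0 : MvPolynomial (Fin k) ℤ)) (Q := (PiP + Dd) * ee 2 - Th * Dd)
    (fun m => by rw [coeff_zero]; exact coeff_aPoly_nonneg_gen m) (r q) (r_nonneg hq)
  rw [eval₂_zero, eval₂_sub, eval₂_mul, eval₂_mul, eval₂_add, sub_nonneg] at h
  exact h

/-- **THE ALL-BUT-TWO CERTIFICATE, (a) discharged.**  For `k ≥ 2` and interior parameters: if `Ñ₂(K_𝒳,K_𝒵)(r) ≥ 0` for all nonempty up-sets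
`𝒳, 𝒵`, then `ρ₂ = μ(· | exactly two closed)` is a reduced transport certificate of `allButTwo k`. [this work] -/
theorem rhoCert_allButTwo_of_N2 {q : Fin k → unitInterval} (hq : ∀ i, 0 < (q i : ℝ) ∧ (q i : ℝ) < 1) (hk : 2 ≤ k)
    (hN : ∀ 𝒳 𝒵 : Set (Set (Fin k)), IsUpperSet 𝒳 → IsUpperSet 𝒵 → 𝒳.Nonempty → 𝒵.Nonempty → 0 ≤ ev q (N2gen (cx 𝒳) (cx 𝒵))) :
    RhoCert q (allButTwo k) (rho2 q) :=
  rhoCert_allButTwo hq hk (aRow hq) hN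

/-- **KAHN'S CONJECTURE 5 / SAHI'S `C₃` FOR THE ALL-BUT-TWO FIRST SLOT ON `k` COORDINATES, CONDITIONAL ONLY ON `Ñ₂ ≥ 0` AT THE ODDS.**  For a
block `e : Fin k ↪ ι` (`k ≥ 2`) with interior parameters, an increasing event `H` determined by the block with pattern event `allButTwo k`
(at most two of the `k` coordinates closed), the (TC) hypothesis `Ñ₂(K_𝒳,K_𝒵)(r) ≥ 0` for all nonempty up-sets of patterns, and ALL increasing
`U, V`: `E₃(1_H, 1_U, 1_V) ≥ 0`. [this work] -/
theorem sahiE_three_nonneg_of_allButTwo_of_N2 {ι : Type} [Fintype ι] (p : ι → unitInterval) (e : Fin k ↪ ι) (hk : 2 ≤ k)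
    (hp : ∀ i, 0 < (p (e i) : ℝ) ∧ (p (e i) : ℝ) < 1)
    (hN : ∀ 𝒳 𝒵 : Set (Set (Fin k)), IsUpperSet 𝒳 → IsUpperSet 𝒵 → 𝒳.Nonempty → 𝒵.Nonempty → 0 ≤ ev (pk e p) (N2gen (cx 𝒳) (cx 𝒵)))
    {H : Set (Set ι)} (hH : DeterminedBy H (Set.range e)) (hpat : pat e H = allButTwo k) {U V : Set (Set ι)} (hU : IsUpperSet U) (hV : IsUpperSet V) :
    0 ≤ sahiE (bernoulliWeight p) 3 ![ind H, ind U, ind V] := by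
  have hq : ∀ i, 0 < (pk e p i : ℝ) ∧ (pk e p i : ℝ) < 1 := hp
  exact sahiE_three_nonneg_of_allButTwo p e hk hp (aRow hq) hN hH hpat hU hV

end SahiAllButTwo

end Summit.CriticalPhenomena.PercolationContinuityZ3.Theorems
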